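import Literature.Computability.Complexity.LadnerToolkit
import HarnessLib

/-!
# Ladner's theorem: simulating a presented oracle procedure against the looked-back oracle

Fifth layer of the discharge of `Literature.Computability.Complexity.ladner` (`StructuralPH.lean`).
The diagonalizer must test a Cook requirement: "does the presented clocked oracle procedure
`⟨e, 1ᵏ⟩` (`Ladner.proc`, `LadnerPresentationCook.lean`), run with oracle `B = {x ∈ A | g |x| even}`,
err on `A` at the candidate `z`?" (Homer–Selman 2011, Lemma 7.2 and Thm. 7.6, proof: the test
`y ∈ SAT ⇔ y ∈ L(M_j, ·)`; Ladner 1975, §3). Within its budget it answers the oracle itself: the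
parity of `g |y|` is read off its table of parities so far, and `y ∈ A` is decided by exhaustive
search (`Ladner.searchFn`). This file builds, in the `FP` string algebra:

* `Ladner.oracleFn χ p` — **the looked-back oracle bit** on `⟨r, ⟨tbl, y⟩⟩`:
  `[ (∃ w, |w| ≤ p|y| ∧ χ ⟨y, w⟩ = 1) ∧ ¬ tbl[|y|] ]` (`oracleFn_apply`), i.e. `[y ∈ B]` when `χ`
  is the indicator of a verifier of `A` with bound `p`, `tbl` the parities of `g` and the ruler
  `r` long enough;
* `Ladner.cookBody χ p`, `Ladner.cookFn χ p` — **the simulation loop**: on `⟨X', z⟩` with context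
  `X' = ⟨r, ⟨tbl, ⟨e, ⟨u₁, u₂⟩⟩⟩⟩` it runs the clocked step `Ladner.stepCore` (code `e`, clocks
  `|u₁|`, `|u₂|`) from the empty transcript for `|u₁| + 1` rounds, answering each query `y` with
  `oracleFn ⟨r, ⟨tbl, y⟩⟩`, and returns the output bit: `cookFn_apply` identifies it with
  `OracleAlg.runAux` of the procedure against any oracle that `oracleFn` computes on the short
  queries (all queries have length `≤ |u₁|`, the query clock).

## References

* S. Homer, A. L. Selman, *Computability and Complexity Theory*, 2nd ed., Springer 2011,
  Lemma 7.2 and Thm. 7.6 (proofs). doi:10.1007/978-1-4614-0682-2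
* R. E. Ladner, *On the structure of polynomial time reducibility*, J. ACM 22 (1975) 155–171, §3.
* S. Arora, B. Barak, *Computational Complexity: A Modern Approach*, CUP 2009, §3.4 (oracle
  machines), §1.3 (bounded loops).
-/

noncomputable section

namespace Literature.Computability.Complexity

open _root_.Computability Polynomial Brick
open HashBricks (headBitFn headBitFn_apply headBitFn_mem_FP oneBit_headBitFn)

namespace Ladner

/-! ### One-bit helpers -/

/-- The length test is one-bit. [folklore] -/
theorem oneBit_lenLeFn (q : Polynomial ℕ) : OneBit (lenLeFn q) := fun w => by
  rcases lenLeFn_eq_or q w with h | h <;> exact ⟨_, h⟩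

/-- The code of an optional bit: `none ↦ ε`, `some b ↦ b`. [folklore] -/
def encOut : Option Bool → List Bool
  | none => []
  | some b => [b]

/-- The state word of the simulation: `⟨z, ⟨answer bits, output code⟩⟩`. [folklore] -/
def stEnc (z as : List Bool) (o : Option Bool) : List Bool :=
  boolPair z (boolPair as (encOut o))

/-! ### The looked-back oracle bit -/

section OracleBit

variable (χ : List Bool → List Bool) (p : Polynomial ℕ)

/-- The parity bit `tbl[|y|]` on `⟨r, ⟨tbl, y⟩⟩` (one-bit: `0` out of range). [folklore] -/
def parityC : List Bool → List Bool :=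
  headBitFn ∘ bitAtFn ∘ fanoutFn (sndPow 1) (nthF 1)

/-- **The looked-back oracle bit** on `⟨r, ⟨tbl, y⟩⟩`: exhaustive search for a certificate of `y`
(ruler `r`) and the complemented parity bit `tbl[|y|]`.
[cite: HomerSelman2011, Thm. 7.6 (proof: "z ∈ L(M_i) △ A is decidable")] -/
def oracleFn : List Bool → List Bool :=
  andFn (headBitFn ∘ searchFn χ p ∘ fanoutFn (nthF 0) (sndPow 1)) (notFn (parityC))

/-- `oracleFn` is one-bit. [folklore] -/
theorem oneBit_oracleFn : OneBit (oracleFn χ p) :=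
  oneBit_andFn (oneBit_headBitFn.comp _) (oneBit_notFn (oneBit_headBitFn.comp _))

/-- `oracleFn ∈ FP` for `χ ∈ FP`. [folklore] -/
theorem oracleFn_mem_FP (hχ : χ ∈ FP) : oracleFn χ p ∈ FP :=
  andFn_mem_FP (comp_mem_FP headBitFn_mem_FP (comp_mem_FP (searchFn_mem_FP χ p hχ)
    (fanoutFn_mem_FP (nthF_mem_FP 0) (sndPow_mem_FP 1))))
    (notFn_mem_FP (comp_mem_FP headBitFn_mem_FP (comp_mem_FP bitAtFn_mem_FP
      (fanoutFn_mem_FP (sndPow_mem_FP 1) (nthF_mem_FP 1)))))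

open Classical in
/-- **Value of the oracle bit** inside the table and with a long ruler. [cite: HomerSelman2011, Thm. 7.6 (proof)] -/
theorem oracleFn_apply {r tbl y : List Bool} (hy : y.length < tbl.length)
    (hr : 2 ^ (p.eval y.length + 1) - 1 ≤ (boolPair r y).length) :
    oracleFn χ p (boolPair r (boolPair tbl y)) =
      [decide (∃ w : List Bool, w.length ≤ p.eval y.length ∧ (χ (boolPair y w)).headD false = true) &&
        !tbl[y.length]] := by
  unfold oracleFn parityC
  have hs := searchFn_apply χ p (r := r) (w := y) hr
  rw [andFn_apply (b := decide (∃ w : List Bool, w.length ≤ p.eval y.length ∧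
      (χ (boolPair y w)).headD false = true)) (b' := !tbl[y.length])]
  · simp [nthF, sndPow, hs]
  · rw [notFn_apply (b := tbl[y.length])]
    simp [nthF, sndPow, bitAtFn_boolPair_of_lt _ _ hy]

end OracleBit

/-! ### One round of the simulation -/

section CookSim

variable (χ : List Bool → List Bool) (p : Polynomial ℕ)

/-- The step code at the current transcript, on the loop record
`ρ = ⟨X', ⟨cnt, ⟨z, ⟨as, out⟩⟩⟩⟩`, `X' = ⟨r, ⟨tbl, ⟨e, ⟨u₁, u₂⟩⟩⟩⟩`:
`stepCore ⟨e, ⟨u₁, ⟨u₂, ⟨z, codeOf as⟩⟩⟩⟩`. [folklore] -/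
def codeF : List Bool → List Bool :=
  stepCore ∘ fanoutFn (nthF 2 ∘ nthF 0) (fanoutFn (nthF 3 ∘ nthF 0) (fanoutFn (sndPow 3 ∘ nthF 0)
    (fanoutFn (nthF 2) (PRelSigma.codeOf ∘ nthF 3))))

/-- The answer to the current query: `oracleFn ⟨r, ⟨tbl, tail code⟩⟩`. [folklore] -/
def ansF : List Bool → List Bool :=
  oracleFn χ p ∘ fanoutFn (nthF 0 ∘ nthF 0) (fanoutFn (nthF 1 ∘ nthF 0) (List.tail ∘ codeF))

/-- **One round**: if an output has been recorded, keep the state; otherwise compute the step code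
— an output `1 b` is recorded, a query `0 y` is answered by the looked-back oracle and the answer
bit appended to the transcript. [cite: HomerSelman2011, Lemma 7.2 (proof)] -/
def cookBody : List Bool → List Bool :=
  iteFn (isNilFn ∘ sndPow 3)
    (iteFn (headBitFn ∘ codeF)
      (fanoutFn (nthF 2) (fanoutFn (nthF 3) (headBitFn ∘ List.tail ∘ codeF)))
      (fanoutFn (nthF 2) (fanoutFn (fun ρ => nthF 3 ρ ++ ansF χ p ρ) (fun _ => []))))
    (sndPow 1)

/-- `codeF ∈ FP`. [folklore] -/
theorem codeF_mem_FP : codeF ∈ FP :=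
  comp_mem_FP stepCore_mem_FP (fanoutFn_mem_FP (comp_mem_FP (nthF_mem_FP 2) (nthF_mem_FP 0))
    (fanoutFn_mem_FP (comp_mem_FP (nthF_mem_FP 3) (nthF_mem_FP 0))
      (fanoutFn_mem_FP (comp_mem_FP (sndPow_mem_FP 3) (nthF_mem_FP 0))
        (fanoutFn_mem_FP (nthF_mem_FP 2) (comp_mem_FP PRelSigma.codeOf_mem_FP (nthF_mem_FP 3))))))

/-- `ansF ∈ FP` for `χ ∈ FP`. [folklore] -/
theorem ansF_mem_FP (hχ : χ ∈ FP) : ansF χ p ∈ FP :=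
  comp_mem_FP (oracleFn_mem_FP χ p hχ) (fanoutFn_mem_FP (comp_mem_FP (nthF_mem_FP 0) (nthF_mem_FP 0))
    (fanoutFn_mem_FP (comp_mem_FP (nthF_mem_FP 1) (nthF_mem_FP 0))
      (comp_mem_FP PRelSigma.tail_mem_FP codeF_mem_FP)))

/-- `cookBody ∈ FP` for `χ ∈ FP`. [cite: AroraBarakCC2009, §1.3] -/
theorem cookBody_mem_FP (hχ : χ ∈ FP) : cookBody χ p ∈ FP :=
  iteFn_mem_FP (comp_mem_FP isNilFn_mem_FP (sndPow_mem_FP 3))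
    (iteFn_mem_FP (comp_mem_FP headBitFn_mem_FP codeF_mem_FP)
      (fanoutFn_mem_FP (nthF_mem_FP 2) (fanoutFn_mem_FP (nthF_mem_FP 3)
        (comp_mem_FP headBitFn_mem_FP (comp_mem_FP PRelSigma.tail_mem_FP codeF_mem_FP))))
      (fanoutFn_mem_FP (nthF_mem_FP 2) (fanoutFn_mem_FP
        (append_mem_FP (nthF_mem_FP 3) (ansF_mem_FP χ p hχ)) (const_mem_FP _))))
    (sndPow_mem_FP 1)

/-- **Growth of one round**: `|cookBody ρ| ≤ |sndPow 1 ρ| + 6` on every input (the transcript gains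
one answer bit, in a doubled field). [folklore] -/
theorem length_cookBody_le (ρ : List Bool) :
    (cookBody χ p ρ).length ≤ (sndPow 1 ρ).length + 6 * ((fstF ρ).length + 1) := by
  have hz : nthF 2 ρ = fstF (sndPow 1 ρ) := rfl
  have has : nthF 3 ρ = fstF (sndF (sndPow 1 ρ)) := rfl
  have hout : sndPow 3 ρ = sndF (sndF (sndPow 1 ρ)) := rfl
  have h1 := length_fstF_sndF_le (sndPow 1 ρ)
  have h2 := length_fstF_sndF_le (sndF (sndPow 1 ρ))
  have hans : (ansF χ p ρ).length = 1 := ((oneBit_oracleFn χ p).comp _).length_eq ρ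
  have hbit : ((headBitFn ∘ List.tail ∘ codeF) ρ).length = 1 := (oneBit_headBitFn.comp _).length_eq ρ
  unfold cookBody
  rw [iteFn_of_oneBit (oneBit_isNilFn.comp _)]
  split_ifs with hnil
  · rw [iteFn_of_oneBit (oneBit_headBitFn.comp _)]
    split_ifs with hhead
    · rw [length_fanoutFn, length_fanoutFn, hbit, hz, has]
      nlinarith [Nat.zero_le (fstF ρ).length]
    · rw [length_fanoutFn, length_fanoutFn, List.length_append, hans, hz, has, List.length_nil]
      nlinarith [Nat.zero_le (fstF ρ).length]
  · nlinarith [Nat.zero_le (fstF ρ).length]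

variable {χ p}

/-- The step code on an honest record. [folklore] -/
theorem codeF_apply (r tbl e u₁ u₂ cnt z as out : List Bool) :
    codeF (boolPair (boolPair r (boolPair tbl (boolPair e (boolPair u₁ u₂))))
      (boolPair cnt (boolPair z (boolPair as out)))) =
      ((encodingList Bool).sumBool encodingBoolBool).encode
        (stepSemCore e u₁.length u₂.length z (PRelSigma.bitsTrans as)) := by
  have h : boolPair z (PRelSigma.codeOf as) = OracleAlg.encIn (z, PRelSigma.bitsTrans as) := rfl
  simp only [codeF, Function.comp_apply, fanoutFn_apply, nthF, sndPow, fstF_boolPair, sndF_boolPair]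
  rw [h, stepCore_apply]

/-- **A frozen round**: once an output bit is recorded the state is kept. [folklore] -/
theorem cookBody_some (X' cnt z as : List Bool) (b : Bool) :
    cookBody χ p (boolPair X' (boolPair cnt (stEnc z as (some b)))) = stEnc z as (some b) := by
  unfold cookBody
  rw [iteFn_apply_false (by simp [sndPow, stEnc, encOut, isNilFn])]
  simp [sndPow, stEnc]

/-- **A live round**: the step code decides between recording the output and extending the
transcript by the looked-back answer. [cite: HomerSelman2011, Lemma 7.2 (proof)] -/
theorem cookBody_none (r tbl e u₁ u₂ cnt z as : List Bool) :
    cookBody χ p (boolPair (boolPair r (boolPair tbl (boolPair e (boolPair u₁ u₂))))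
      (boolPair cnt (stEnc z as none))) =
      match stepSemCore e u₁.length u₂.length z (PRelSigma.bitsTrans as) with
      | Sum.inr b => stEnc z as (some b)
      | Sum.inl y => stEnc z (as ++ oracleFn χ p (boolPair r (boolPair tbl y))) none := by
  have hcode := codeF_apply r tbl e u₁ u₂ cnt z as []
  unfold cookBody
  rw [iteFn_apply_true (by simp [sndPow, stEnc, encOut, isNilFn])]
  cases hs : stepSemCore e u₁.length u₂.length z (PRelSigma.bitsTrans as) with
  | inr b =>
    rw [hs, sumBool_encode_inr] at hcode
    rw [iteFn_apply_true (by simp [Function.comp_apply, stEnc, encOut, hcode])]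
    simp [Function.comp_apply, stEnc, encOut, hcode, nthF]
  | inl y =>
    rw [hs, sumBool_encode_inl] at hcode
    rw [iteFn_apply_false (by simp [Function.comp_apply, stEnc, encOut, hcode])]
    simp [Function.comp_apply, stEnc, encOut, hcode, nthF, ansF]

end CookSim

/-! ### The simulation loop and its output -/

section Loop

variable (χ : List Bool → List Bool) (p : Polynomial ℕ)

/-- **The simulation loop**, clocked by the context field. [cite: AroraBarakCC2009, §1.3 (bounded loops)] -/
def cookLoop : List Bool → List Bool :=
  fun ρ => (loopStep (cookBody χ p))^[(X : Polynomial ℕ).eval (fstF ρ).length] ρ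

/-- `cookLoop ∈ FP` for `χ ∈ FP`. [cite: AroraBarakCC2009, §1.3] -/
theorem cookLoop_mem_FP (hχ : χ ∈ FP) : cookLoop χ p ∈ FP :=
  loopFn_mem_FP (cookBody_mem_FP χ p hχ) (length_cookBody_le χ p) X

/-- **The simulation brick** on `⟨X', z⟩`, `X' = ⟨r, ⟨tbl, ⟨e, ⟨u₁, u₂⟩⟩⟩⟩`: the loop from the empty
transcript with countdown `|u₁| + 1`, then the output code. [cite: HomerSelman2011, Lemma 7.2 (proof)] -/
def cookFn : List Bool → List Bool :=
  sndPow 3 ∘ cookLoop χ p ∘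
    fanoutFn fstF (fanoutFn (lenBinF ∘ List.cons true ∘ nthF 3 ∘ fstF) (fanoutFn sndF (fun _ => boolPair [] [])))

/-- `cookFn ∈ FP` for `χ ∈ FP`. [cite: AroraBarakCC2009, §1.3] -/
theorem cookFn_mem_FP (hχ : χ ∈ FP) : cookFn χ p ∈ FP :=
  comp_mem_FP (sndPow_mem_FP 3) (comp_mem_FP (cookLoop_mem_FP χ p hχ)
    (fanoutFn_mem_FP fstF_mem_FP (fanoutFn_mem_FP
      (comp_mem_FP lenBinF_mem_FP (comp_mem_FP (cons_mem_FP true) (comp_mem_FP (nthF_mem_FP 3) fstF_mem_FP)))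
      (fanoutFn_mem_FP sndF_mem_FP (const_mem_FP _)))))

variable {χ p}

/-- Frozen rounds: from a state with a recorded output the loop model is constant. [folklore] -/
theorem loopModel_cookBody_some (X' z as : List Bool) (b : Bool) :
    ∀ k : ℕ, loopModel (cookBody χ p) X' k (stEnc z as (some b)) = stEnc z as (some b)
  | 0 => rfl
  | k + 1 => by rw [loopModel, cookBody_some]; exact loopModel_cookBody_some X' z as b k

/-- **The loop simulates the procedure** against every oracle whose bits the looked-back oracle
computes on the short queries: `k` rounds from transcript `as` (one-bit answers) end, for some
extended transcript, with the output code of `OracleAlg.runAux` of the procedure with fuel `k`.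
[cite: HomerSelman2011, Lemma 7.2 (proof)] -/
theorem loopModel_cookBody {r tbl e u₁ u₂ : List Bool} {O : List Bool → Bool}
    (hO : ∀ y : List Bool, y.length ≤ u₁.length → oracleFn χ p (boolPair r (boolPair tbl y)) = [O y])
    (z : List Bool) : ∀ (k : ℕ) (as : List Bool), ∃ as' : List Bool,
      loopModel (cookBody χ p) (boolPair r (boolPair tbl (boolPair e (boolPair u₁ u₂)))) k (stEnc z as none) =
        stEnc z as' ((procCore e u₁.length u₂.length).runAux (fun y => [O y]) z k (PRelSigma.bitsTrans as))
  | 0, as => ⟨as, rfl⟩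
  | k + 1, as => by
    rw [loopModel, cookBody_none, OracleAlg.runAux_succ]
    dsimp only [procCore]
    cases hs : stepSemCore e u₁.length u₂.length z (PRelSigma.bitsTrans as) with
    | inr b => exact ⟨as, loopModel_cookBody_some _ z as b k⟩
    | inl y =>
      dsimp only
      rw [hO y (length_query_le_core hs), show PRelSigma.bitsTrans as ++ [[O y]] =
        PRelSigma.bitsTrans (as ++ [O y]) by simp]
      exact loopModel_cookBody hO z k (as ++ [O y])

/-- **Value of the simulation brick**: the output code of the procedure `⟨e; |u₁|, |u₂|⟩` run on
`z` with fuel `|u₁| + 1` against any oracle that the looked-back oracle computes on the queries of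
length `≤ |u₁|`. [cite: HomerSelman2011, Lemma 7.2 (proof)] -/
theorem cookFn_apply {r tbl e u₁ u₂ : List Bool} {O : List Bool → Bool}
    (hO : ∀ y : List Bool, y.length ≤ u₁.length → oracleFn χ p (boolPair r (boolPair tbl y)) = [O y])
    (z : List Bool) :
    cookFn χ p (boolPair (boolPair r (boolPair tbl (boolPair e (boolPair u₁ u₂)))) z) =
      encOut ((procCore e u₁.length u₂.length).runAux (fun y => [O y]) z (u₁.length + 1) []) := by
  set X' := boolPair r (boolPair tbl (boolPair e (boolPair u₁ u₂))) with hX'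
  have hk : u₁.length + 1 ≤ (X : Polynomial ℕ).eval X'.length := by
    rw [eval_X, hX']; simp only [length_boolPair]; omega
  have hu₁ : nthF 3 X' = u₁ := by simp [hX', nthF]
  obtain ⟨as', has'⟩ := loopModel_cookBody hO z (u₁.length + 1) []
  simp only [cookFn, cookLoop, Function.comp_apply, fanoutFn_apply, fstF_boolPair, sndF_boolPair, hu₁,
    lenBinF_apply, List.length_cons]
  rw [show boolPair z (boolPair [] []) = stEnc z [] none from rfl, iterate_loopStep _ _ _ _ _ hk, has']
  simp [sndPow, stEnc]

end Loop

end Ladner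

end Literature.Computability.Complexity

end
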